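import Summits.QuantumFields.YangMills.Theorems.UnitScaleTiltProp7CutoffLaplacianLetters
import HarnessLib

/-!
# Route `UnitScaleTilt`, crux «MinimiserStabilityRegPr» (stmt-QuantumFields-19200, stub EX), EX row `hGF`[Lift] (curved member), the LOD line, ★p1 g24's `LOCATE-L6-ASSEMBLY`
# §1 Step I.2 pen (L5″) (routeR-w3 g12, «px5: (M) — GO») — **(M-I) THE MEMBER FORM ROWS OF THE CUT-OFF COMPARISON, LAPLACIAN PART: for two backgrounds `U, V` that are
# `δη`-close on the support of a real cutoff `χ` with bond steps `≤ θ`, the twisted difference `χ·Δ_V − Δ_U·χ` tested between `z` and `w` is bounded by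
# `(c‖D_Vw‖ + c‖w‖)(‖D_Uz‖ + ‖z‖)` with `c = √3η⁻¹θ + √24·δ + 2√3η⁻¹θ·√24δ`** — the `hform` binder of ✓p750050 `Prop7CutoffResolventComparison.norm_inv_cutoff_comm_le_of_form`
# for the MASSLESS systems; K-free when `θ ≤ η∕(R″−R′)` (block-Lipschitz `χ`, chair pin (P2)) and `δ = 6R″ε₀` ([B6] Lemma 1) (ym3-torus-px5 g11, `LOCATE-L5pp-localisation-px5g11.md`).

Cell `ym3-torus` (HUMAN RULING D-0037: YM₃ on T³ is ladder rung R3 — NOT d = 4, NOT infinite volume, NOT a mass gap, NOT Clay).  Width seat `ym3-torus-px5` (gen 11; WIDTH COPY of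
ym3-torus-p1).  THEOREMS ONLY (0 `def`, 0 `sorry`); `--supports stmt-QuantumFields-19200 --as helper`, count-neutral.  HONEST LABEL (№33 (6)): curved γ-row supplier line (LOD
localisation); member letters for (L5″)∕(L5); nothing of (L5″), (L6), (3.49), `h349`, `hGF`, EX ∕ 19200 is proved.

THE POINT.  `X A_V − A_U X = (XΔ_V − Δ_V X) + (Δ_V − Δ_U)X` (+ mass terms, FILE (M-II)).  Both pieces are second order, small only as FORMS, and each pairing sees `U − V` only through
bonds meeting `supp χ` ∪ {bonds along which `χ` changes}: (i) the commutator `⟪z, (χΔ_V − Δ_Vχ)w⟫ = ⟪K_χz, D_Vw⟫ − ⟪D_Vz, K_χw⟫` with the Leibniz defect `K_χy(b) =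
η⁻¹(χ(b₊) − χ(b₋))·Ad(V_b)y(b₊)` (✓`Prop7Lane2CutoffCommutators.DL2_smul_sub_smul_eq_toL2`; the `χ(b₋)·` parts cancel by symmetry of real bond multipliers, FILE A
`inner_toL2_smul_left`), `‖K_χy‖ ≤ √3η⁻¹θ‖y‖`, and `D_Vz = D_Uz − (D_U − D_V)z` where ONLY the bonds carrying `K_χw` count: there `‖U_b − V_b‖ ≤ δη` makes `η⁻¹(Ad U_b − Ad V_b)`
BOUNDED by `2δ`; (ii) `⟪z, (Δ_V − Δ_U)(χw)⟫ = ⟪(D_V − D_U)z, D_V(χw)⟫ + ⟪D_Uz, (D_V − D_U)(χw)⟫` with the same locality.  No `η⁻¹` survives except the displayed `η⁻¹θ`.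

WHAT IS PROVED (sorry-free, no definition; ns `…Theorems.Prop7CutoffLaplacianFormRows`; letters = ✓`…Prop7CutoffLaplacianLetters`; multiplier `X` with `hX : X(toL2S l) = toL2S(χ·l)`).
* §1 ★★`abs_re_inner_comm_covLapSite_le` — `|re⟪toL2S z, X(Δ_V(toL2S w)) − Δ_V(X(toL2S w))⟫| ≤ √3η⁻¹θ·(‖toL2S z‖‖D_V(toL2S w)‖ + ‖toL2S w‖(‖D_U(toL2S z)‖ + √24δ‖toL2S z‖))`.
* §2 ★★`abs_re_inner_covLapSite_sub_smul_le` — `|re⟪toL2S z, (Δ_V − Δ_U)(toL2S(χ·w))⟫| ≤ √24δ·(‖toL2S w‖‖D_U(toL2S z)‖ + ‖toL2S z‖(‖D_V(toL2S w)‖ + √3η⁻¹θ‖toL2S w‖))` (`|χ| ≤ 1`).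
* §3 ★★★`abs_re_inner_twisted_laplacian_le` — the SUM in ✓p750050's `hform` shape: `≤ (c‖D_V(toL2S w)‖ + c‖toL2S w‖)·(‖D_U(toL2S z)‖ + ‖toL2S z‖)`, `c = √3η⁻¹θ + √24δ + 2√3η⁻¹θ√24δ`.
HONEST SCOPE.  Member bookkeeping over landed Leibniz rows; no mass term (FILE (M-II)), no inverse, no decay; nothing of (L5″)∕(L6), `hGF`, `h349`, EX or the crux is proved here.

References: T. Bałaban, CMP **99** (1985) 389–434 [Balaban1985BackgroundPropagators] ((3.3) p.391, (3.8) p.392, (3.100)–(3.105) pp.413–414, Thm 3.3 p.399); CMP **96** (1984) 223–250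
[Balaban1984PropagatorsII] (p.238); CMP **99** (1985) 75–102 [Balaban1985RegularSpaces] (Lemma 1 (1.25) p.79, the axial gauge on a cube).
-/

set_option autoImplicit false

noncomputable section

open scoped BigOperators Matrix.Norms.L2Operator InnerProductSpace ComplexConjugate

namespace Summit.QuantumFields.YangMills.Theorems.Prop7CutoffLaplacianFormRows

open Literature.MathematicalPhysics.QuantumFieldTheory.Balaban1983to89
open Finset
open B7Prop1Explicit (U1)
open B7Eq78Linearization (conjR conjR_apply)
open B9Eq39Adjoint (R)
open B11Eq103H1Complex (SiteL2K BondL2K)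
open Literature.MathematicalPhysics.QuantumFieldTheory.Balaban1983to89.T3ContinuumYM3Torus
open T3SectALandauChart (eta eta_pos bgUnits covDerivFwdT)
open Summit.QuantumFields.YangMills.Theorems.Prop7SectET3Transport (periodsT3)
open Summit.QuantumFields.YangMills.Theorems.Prop7SectET3HilbertLetters (W₂ toL2 toL2S DL2 DstarL2 covLapSite adjoint_DL2 inner_toL2)
open Summit.QuantumFields.YangMills.Theorems.Prop7SectET3RealCoordSums (inner_toL2S)
open Summit.QuantumFields.YangMills.Theorems.Prop7LaplaceAFlatLetters (norm_sq_toL2 norm_sq_toL2S)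
open Summit.QuantumFields.YangMills.Theorems.Prop7Lane2CutoffCommutators (DL2_smul_sub_smul_eq_toL2 norm_sq_DL2_smul_sub_le sum_pbond_tgt coe_bgUnits_mem_unitary')
open Summit.QuantumFields.YangMills.Theorems.Prop7LandauDict (DL2_toL2S_eq_covDerivFwdT)
open Summit.QuantumFields.YangMills.Theorems.Prop7CovariantCoercivity (norm_conjR_sub_conjR_le sum_norm_sq_le_mul_opNorm_sq sum_norm_sq_R)
open Summit.QuantumFields.YangMills.Theorems.Prop7SymAvgTwSym (unitsField_toUField_mem_U1')
open Summit.QuantumFields.YangMills.Theorems.Prop7MassivePropagatorAgmonLetters (inner_toL2S_smul_left inner_toL2_smul_left norm_toL2S_smul_le)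
open Summit.QuantumFields.YangMills.Theorems.Prop7CutoffLaplacianLetters

variable (F : T3Family) {n K : ℕ} {c₀ : ℝ} [Fact (0 < c₀)]
  (U V : GaugeField (F.P K) 0 (Matrix.specialUnitaryGroup (Fin 2) ℂ))

/-! ## §1 The commutator of the cutoff with `Δ_V`, in form sense -/

/-- ★★ **THE CUT-OFF COMMUTATOR ROW**: `|χ(b₊) − χ(b₋)| ≤ θ` on every bond, `‖U_b − V_b‖ ≤ δη` on the bonds along which `χ` changes, `X = χ·` ⟹
`|re⟪toL2S z, X(Δ_V(toL2S w)) − Δ_V(X(toL2S w))⟫| ≤ √3η⁻¹θ·(‖toL2S z‖·‖D_V(toL2S w)‖ + ‖toL2S w‖·(‖D_U(toL2S z)‖ + √24·δ·‖toL2S z‖))`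
(`⟪z, (χΔ_V − Δ_Vχ)w⟫ = ⟪K_χz, D_Vw⟫ − ⟪D_Vz, K_χw⟫`; in the second pairing `D_Vz = D_Uz − (D_U − D_V)z` and only the bonds carrying `K_χw` count).
[cite: Balaban1985BackgroundPropagators, (3.100)–(3.105) pp.413–414, Thm 3.3 p.399; Balaban1984PropagatorsII, p.238] -/
theorem abs_re_inner_comm_covLapSite_le (χ : Site (F.P K) 0 → ℝ) {θ δ : ℝ} (hθ : 0 ≤ θ) (hδ : 0 ≤ δ)
    (hχ : ∀ (x : Site (F.P K) 0) (μ : Fin 3), |χ (x.shift μ) - χ x| ≤ θ)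
    (hUV : ∀ b : PBond (F.P K) 0, χ b.tgt ≠ χ b.src →
      ‖((bgUnits F K U b : (Matrix (Fin 2) (Fin 2) ℂ)ˣ) : Matrix (Fin 2) (Fin 2) ℂ) - ((bgUnits F K V b : (Matrix (Fin 2) (Fin 2) ℂ)ˣ) : Matrix (Fin 2) (Fin 2) ℂ)‖ ≤ δ * eta F n K)
    (X : SiteL2K ℂ 3 (periodsT3 F K) c₀ W₂ →ₗ[ℂ] SiteL2K ℂ 3 (periodsT3 F K) c₀ W₂)
    (hX : ∀ l : Site (F.P K) 0 → Matrix (Fin 2) (Fin 2) ℂ, X (toL2S F K c₀ l) = toL2S F K c₀ (fun x => χ x • l x))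
    (z w : Site (F.P K) 0 → Matrix (Fin 2) (Fin 2) ℂ) :
    |RCLike.re ⟪toL2S F K c₀ z, X (covLapSite F n K c₀ V (toL2S F K c₀ w)) - covLapSite F n K c₀ V (X (toL2S F K c₀ w))⟫_ℂ|
      ≤ Real.sqrt 3 * (eta F n K)⁻¹ * θ * (‖toL2S F K c₀ z‖ * ‖DL2 F n K c₀ V (toL2S F K c₀ w)‖
          + ‖toL2S F K c₀ w‖ * (‖DL2 F n K c₀ U (toL2S F K c₀ z)‖ + Real.sqrt 24 * δ * ‖toL2S F K c₀ z‖)) := by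
  classical
  have hη : 0 < eta F n K := eta_pos F n K
  -- letters
  set Z := toL2S F K c₀ z with hZ
  set W := toL2S F K c₀ w with hW
  set DVW := DL2 F n K c₀ V W with hDVW
  set DVZ := DL2 F n K c₀ V Z with hDVZ
  set DUZ := DL2 F n K c₀ U Z with hDUZ
  -- the Leibniz defects
  set Kz : BondL2K ℂ 3 (periodsT3 F K) c₀ W₂ := DL2 F n K c₀ V (toL2S F K c₀ (fun x => χ x • z x)) - toL2 F K c₀ (fun b => χ b.src • (toL2 F K c₀).symm DVZ b) with hKz
  set Kw : BondL2K ℂ 3 (periodsT3 F K) c₀ W₂ := DL2 F n K c₀ V (toL2S F K c₀ (fun x => χ x • w x)) - toL2 F K c₀ (fun b => χ b.src • (toL2 F K c₀).symm DVW b) with hKw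
  have hKz_le : ‖Kz‖ ≤ Real.sqrt 3 * (eta F n K)⁻¹ * θ * ‖Z‖ := norm_leibnizDefect_le F (n := n) (c₀ := c₀) V χ hθ hχ z
  have hKw_le : ‖Kw‖ ≤ Real.sqrt 3 * (eta F n K)⁻¹ * θ * ‖W‖ := norm_leibnizDefect_le F (n := n) (c₀ := c₀) V χ hθ hχ w
  -- rewrite the two pairings through `⟪·, Δ_V ·⟫ = ⟪D_V ·, D_V ·⟫`
  have hadj : ∀ a b : SiteL2K ℂ 3 (periodsT3 F K) c₀ W₂, ⟪a, covLapSite F n K c₀ V b⟫_ℂ = ⟪DL2 F n K c₀ V a, DL2 F n K c₀ V b⟫_ℂ := fun a b => by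
    rw [Summit.QuantumFields.YangMills.Theorems.Prop7SectET3HilbertLetters.covLapSite, LinearMap.comp_apply, ← adjoint_DL2, LinearMap.adjoint_inner_right]
  have h1 : ⟪Z, X (covLapSite F n K c₀ V W)⟫_ℂ = ⟪DL2 F n K c₀ V (toL2S F K c₀ (fun x => χ x • z x)), DVW⟫_ℂ := by
    obtain ⟨g, hg⟩ : ∃ g, covLapSite F n K c₀ V W = toL2S F K c₀ g := ⟨(toL2S F K c₀).symm _, ((toL2S F K c₀).apply_symm_apply _).symm⟩
    rw [hg, hX, hZ, ← inner_toL2S_smul_left, ← hg, hadj]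
  have h2 : ⟪Z, covLapSite F n K c₀ V (X W)⟫_ℂ = ⟪DVZ, DL2 F n K c₀ V (toL2S F K c₀ (fun x => χ x • w x))⟫_ℂ := by
    rw [hadj, hW, hX]
  -- the `χ(b₋)·` parts cancel
  have hDVW_eq : DVW = toL2 F K c₀ ((toL2 F K c₀).symm DVW) := ((toL2 F K c₀).apply_symm_apply _).symm
  have hDVZ_eq : DVZ = toL2 F K c₀ ((toL2 F K c₀).symm DVZ) := ((toL2 F K c₀).apply_symm_apply _).symm
  have hcancel : ⟪toL2 F K c₀ (fun b => χ b.src • (toL2 F K c₀).symm DVZ b), DVW⟫_ℂ = ⟪DVZ, toL2 F K c₀ (fun b => χ b.src • (toL2 F K c₀).symm DVW b)⟫_ℂ := by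
    conv_lhs => rw [hDVW_eq]
    conv_rhs => rw [hDVZ_eq]
    exact inner_toL2_smul_left F (fun b => χ b.src) _ _
  have hmain : ⟪Z, X (covLapSite F n K c₀ V W) - covLapSite F n K c₀ V (X W)⟫_ℂ = ⟪Kz, DVW⟫_ℂ - ⟪DVZ, Kw⟫_ℂ := by
    rw [inner_sub_right, h1, h2]
    have eKz : DL2 F n K c₀ V (toL2S F K c₀ (fun x => χ x • z x)) = Kz + toL2 F K c₀ (fun b => χ b.src • (toL2 F K c₀).symm DVZ b) := by rw [hKz, sub_add_cancel]
    have eKw : DL2 F n K c₀ V (toL2S F K c₀ (fun x => χ x • w x)) = Kw + toL2 F K c₀ (fun b => χ b.src • (toL2 F K c₀).symm DVW b) := by rw [hKw, sub_add_cancel]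
    rw [eKz, eKw, inner_add_left, inner_add_right, hcancel]
    ring
  -- the second pairing: `D_Vz = D_Uz − (D_U − D_V)z`, and `Kw` lives on the bonds along which `χ` changes
  set S : Finset (PBond (F.P K) 0) := Finset.univ.filter (fun b => χ b.tgt ≠ χ b.src) with hS
  have hKw_supp : ∀ b, b ∉ S → (toL2 F K c₀).symm Kw b = 0 := by
    intro b hb
    have hbeq : χ b.tgt = χ b.src := by
      by_contra hne
      exact hb (Finset.mem_filter.mpr ⟨Finset.mem_univ _, hne⟩)
    rw [hKw, hDVW, hW, DL2_smul_sub_smul_eq_toL2, LinearEquiv.symm_apply_apply, hbeq, sub_self, mul_zero, zero_smul]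
  have hdiff : ‖⟪DVZ, Kw⟫_ℂ‖ ≤ ‖DUZ‖ * ‖Kw‖ + Real.sqrt 24 * δ * ‖Z‖ * ‖Kw‖ := by
    have e : DVZ = DUZ - (DUZ - DVZ) := by rw [sub_sub_cancel]
    rw [e, inner_sub_left]
    refine (norm_sub_le _ _).trans (add_le_add (norm_inner_le_norm _ _) ?_)
    -- the difference pairs with `Kw` only on `S`
    have hKw_eq : Kw = toL2 F K c₀ ((toL2 F K c₀).symm Kw) := ((toL2 F K c₀).apply_symm_apply _).symm
    have hD_eq : DUZ - DVZ = toL2 F K c₀ ((toL2 F K c₀).symm (DUZ - DVZ)) := ((toL2 F K c₀).apply_symm_apply _).symm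
    rw [hKw_eq, hD_eq]
    refine (norm_inner_toL2_le_of_support F _ _ S hKw_supp).trans ?_
    rw [← hKw_eq]
    refine mul_le_mul_of_nonneg_right ?_ (norm_nonneg _)
    have hsq := normSq_on_DL2_sub_DL2_le F (n := n) (c₀ := c₀) U V z S (δ := δ) (fun b hb => hUV b (Finset.mem_filter.mp hb).2)
    rw [← hZ, ← hDUZ, ← hDVZ] at hsq
    calc Real.sqrt (c₀ * ∑ b ∈ S, ∑ j : Fin 2, ∑ k : Fin 2, ‖((toL2 F K c₀).symm (DUZ - DVZ) b) j k‖ ^ 2)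
        ≤ Real.sqrt (24 * δ ^ 2 * ‖Z‖ ^ 2) := Real.sqrt_le_sqrt hsq
      _ = Real.sqrt 24 * δ * ‖Z‖ := by
          rw [Real.sqrt_mul' _ (sq_nonneg _), Real.sqrt_mul' _ (sq_nonneg _), Real.sqrt_sq hδ, Real.sqrt_sq (norm_nonneg _)]
  -- assemble
  rw [hmain, map_sub]
  have hA : |RCLike.re ⟪Kz, DVW⟫_ℂ| ≤ ‖Kz‖ * ‖DVW‖ := (RCLike.abs_re_le_norm _).trans (norm_inner_le_norm _ _)
  have hB : |RCLike.re ⟪DVZ, Kw⟫_ℂ| ≤ ‖DUZ‖ * ‖Kw‖ + Real.sqrt 24 * δ * ‖Z‖ * ‖Kw‖ := (RCLike.abs_re_le_norm _).trans hdiff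
  have hab := abs_sub _ _ |>.trans (add_le_add hA hB)
  have hDVW0 : 0 ≤ ‖DVW‖ := norm_nonneg _
  have hDUZ0 : 0 ≤ ‖DUZ‖ := norm_nonneg _
  have hZ0 : 0 ≤ ‖Z‖ := norm_nonneg _
  have hW0 : 0 ≤ ‖W‖ := norm_nonneg _
  have h24 : 0 ≤ Real.sqrt 24 * δ * ‖Z‖ := by positivity
  calc |RCLike.re ⟪Kz, DVW⟫_ℂ - RCLike.re ⟪DVZ, Kw⟫_ℂ| ≤ ‖Kz‖ * ‖DVW‖ + (‖DUZ‖ * ‖Kw‖ + Real.sqrt 24 * δ * ‖Z‖ * ‖Kw‖) := hab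
    _ ≤ (Real.sqrt 3 * (eta F n K)⁻¹ * θ * ‖Z‖) * ‖DVW‖ + (‖DUZ‖ * (Real.sqrt 3 * (eta F n K)⁻¹ * θ * ‖W‖) + Real.sqrt 24 * δ * ‖Z‖ * (Real.sqrt 3 * (eta F n K)⁻¹ * θ * ‖W‖)) :=
        add_le_add (mul_le_mul_of_nonneg_right hKz_le hDVW0) (add_le_add (mul_le_mul_of_nonneg_left hKw_le hDUZ0) (mul_le_mul_of_nonneg_left hKw_le h24))
    _ = _ := by ring

/-! ## §2 The difference of the two Laplacians on the cut-off vector, in form sense -/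

/-- ★★ **THE LOCAL LAPLACIAN DIFFERENCE ROW**: `|χ| ≤ 1`, `|χ(b₊) − χ(b₋)| ≤ θ`, and `‖U_b − V_b‖ ≤ δη` on every bond MEETING `supp χ` (`χ(b₊) ≠ 0 ∨ χ(b₋) ≠ 0`) ⟹
`|re⟪toL2S z, (Δ_V − Δ_U)(toL2S(χ·w))⟫| ≤ √24δ·(‖toL2S w‖·‖D_U(toL2S z)‖ + ‖toL2S z‖·(‖D_V(toL2S w)‖ + √3η⁻¹θ·‖toL2S w‖))`
(`= re(⟪(D_V − D_U)z, D_V(χw)⟫ + ⟪D_Uz, (D_V − D_U)(χw)⟫)`; the first pairing lives on the bonds meeting `supp χ`). [cite: Balaban1985BackgroundPropagators, (3.105) p.414, Thm 3.3 p.399] -/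
theorem abs_re_inner_covLapSite_sub_smul_le (χ : Site (F.P K) 0 → ℝ) {θ δ : ℝ} (hθ : 0 ≤ θ) (hδ : 0 ≤ δ) (hχ1 : ∀ x, |χ x| ≤ 1)
    (hχ : ∀ (x : Site (F.P K) 0) (μ : Fin 3), |χ (x.shift μ) - χ x| ≤ θ)
    (hUV : ∀ b : PBond (F.P K) 0, (χ b.tgt ≠ 0 ∨ χ b.src ≠ 0) →
      ‖((bgUnits F K U b : (Matrix (Fin 2) (Fin 2) ℂ)ˣ) : Matrix (Fin 2) (Fin 2) ℂ) - ((bgUnits F K V b : (Matrix (Fin 2) (Fin 2) ℂ)ˣ) : Matrix (Fin 2) (Fin 2) ℂ)‖ ≤ δ * eta F n K)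
    (z w : Site (F.P K) 0 → Matrix (Fin 2) (Fin 2) ℂ) :
    |RCLike.re ⟪toL2S F K c₀ z, covLapSite F n K c₀ V (toL2S F K c₀ (fun x => χ x • w x)) - covLapSite F n K c₀ U (toL2S F K c₀ (fun x => χ x • w x))⟫_ℂ|
      ≤ Real.sqrt 24 * δ * (‖toL2S F K c₀ w‖ * ‖DL2 F n K c₀ U (toL2S F K c₀ z)‖
          + ‖toL2S F K c₀ z‖ * (‖DL2 F n K c₀ V (toL2S F K c₀ w)‖ + Real.sqrt 3 * (eta F n K)⁻¹ * θ * ‖toL2S F K c₀ w‖)) := by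
  classical
  have hη : 0 < eta F n K := eta_pos F n K
  set Z := toL2S F K c₀ z with hZ
  set W := toL2S F K c₀ w with hW
  set CW := toL2S F K c₀ (fun x => χ x • w x) with hCW
  set DVZ := DL2 F n K c₀ V Z with hDVZ
  set DUZ := DL2 F n K c₀ U Z with hDUZ
  set DVW := DL2 F n K c₀ V W with hDVW
  have hadjV : ∀ a b : SiteL2K ℂ 3 (periodsT3 F K) c₀ W₂, ⟪a, covLapSite F n K c₀ V b⟫_ℂ = ⟪DL2 F n K c₀ V a, DL2 F n K c₀ V b⟫_ℂ := fun a b => by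
    rw [Summit.QuantumFields.YangMills.Theorems.Prop7SectET3HilbertLetters.covLapSite, LinearMap.comp_apply, ← adjoint_DL2, LinearMap.adjoint_inner_right]
  have hadjU : ∀ a b : SiteL2K ℂ 3 (periodsT3 F K) c₀ W₂, ⟪a, covLapSite F n K c₀ U b⟫_ℂ = ⟪DL2 F n K c₀ U a, DL2 F n K c₀ U b⟫_ℂ := fun a b => by
    rw [Summit.QuantumFields.YangMills.Theorems.Prop7SectET3HilbertLetters.covLapSite, LinearMap.comp_apply, ← adjoint_DL2, LinearMap.adjoint_inner_right]
  have hmain : ⟪Z, covLapSite F n K c₀ V CW - covLapSite F n K c₀ U CW⟫_ℂ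
      = ⟪DVZ - DUZ, DL2 F n K c₀ V CW⟫_ℂ + ⟪DUZ, DL2 F n K c₀ V CW - DL2 F n K c₀ U CW⟫_ℂ := by
    rw [inner_sub_right, hadjV, hadjU, inner_sub_left, inner_sub_right]; ring
  -- ‖CW‖ ≤ ‖W‖
  have hCW_le : ‖CW‖ ≤ ‖W‖ := by
    have := norm_toL2S_smul_le F (c₀ := c₀) χ zero_le_one hχ1 w
    rw [one_mul] at this; exact this
  -- term 2: `(D_V − D_U)(χw)` lives on bonds with `χ(b₊) ≠ 0`
  have hT2 : ‖DL2 F n K c₀ V CW - DL2 F n K c₀ U CW‖ ≤ Real.sqrt 24 * δ * ‖W‖ := by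
    set S : Finset (PBond (F.P K) 0) := Finset.univ.filter (fun b => χ b.tgt ≠ 0) with hS
    have hsq := normSq_on_DL2_sub_DL2_le F (n := n) (c₀ := c₀) V U (fun x => χ x • w x) S (δ := δ) (fun b hb => by
      rw [norm_sub_rev]; exact hUV b (Or.inl (Finset.mem_filter.mp hb).2))
    -- off `S` the entries vanish, so the `S`-sum is the full sum
    have hfull : c₀ * ∑ b ∈ S, ∑ j : Fin 2, ∑ k : Fin 2, ‖((toL2 F K c₀).symm (DL2 F n K c₀ V CW - DL2 F n K c₀ U CW) b) j k‖ ^ 2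
        = ‖DL2 F n K c₀ V CW - DL2 F n K c₀ U CW‖ ^ 2 := by
      have e : DL2 F n K c₀ V CW - DL2 F n K c₀ U CW = toL2 F K c₀ ((toL2 F K c₀).symm (DL2 F n K c₀ V CW - DL2 F n K c₀ U CW)) :=
        ((toL2 F K c₀).apply_symm_apply _).symm
      conv_rhs => rw [e, norm_sq_toL2]
      congr 1
      rw [← Finset.sum_filter_add_sum_filter_not Finset.univ (fun b : PBond (F.P K) 0 => χ b.tgt ≠ 0)]
      have h0 : ∑ b ∈ Finset.univ.filter (fun b : PBond (F.P K) 0 => ¬ χ b.tgt ≠ 0),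
          ∑ i : Fin 2, ∑ i' : Fin 2, ‖((toL2 F K c₀).symm (DL2 F n K c₀ V CW - DL2 F n K c₀ U CW) b) i i'‖ ^ 2 = 0 := by
        refine Finset.sum_eq_zero fun b hb => ?_
        have hb0 : χ b.tgt = 0 := not_not.mp (Finset.mem_filter.mp hb).2
        rw [hCW, DL2_sub_DL2_symm_apply]
        simp [hb0, conjR_apply]
      rw [h0, add_zero]
    rw [hfull, hCW] at hsq
    have h2 : ‖DL2 F n K c₀ V CW - DL2 F n K c₀ U CW‖ ^ 2 ≤ (Real.sqrt 24 * δ * ‖W‖) ^ 2 := by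
      rw [mul_pow, mul_pow, Real.sq_sqrt (by norm_num : (0:ℝ) ≤ 24)]
      calc _ ≤ 24 * δ ^ 2 * ‖toL2S F K c₀ (fun x => χ x • w x)‖ ^ 2 := hsq
        _ ≤ 24 * δ ^ 2 * ‖W‖ ^ 2 := mul_le_mul_of_nonneg_left (pow_le_pow_left₀ (norm_nonneg _) hCW_le 2) (by positivity)
    exact (pow_le_pow_iff_left₀ (norm_nonneg _) (by positivity) two_ne_zero).1 h2
  -- term 1: `D_V(χw)` lives on bonds meeting `supp χ`
  set S' : Finset (PBond (F.P K) 0) := Finset.univ.filter (fun b => χ b.tgt ≠ 0 ∨ χ b.src ≠ 0) with hS'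
  have hsupp : ∀ b, b ∉ S' → (toL2 F K c₀).symm (DL2 F n K c₀ V CW) b = 0 := by
    intro b hb
    have h0 : χ b.tgt = 0 ∧ χ b.src = 0 :=
      ⟨by_contra fun h => hb (Finset.mem_filter.mpr ⟨Finset.mem_univ _, Or.inl h⟩),
       by_contra fun h => hb (Finset.mem_filter.mpr ⟨Finset.mem_univ _, Or.inr h⟩)⟩
    rw [hCW, DL2_toL2S_eq_covDerivFwdT]
    have ht : χ (b.src.shift b.dir) = 0 := h0.1
    simp [covDerivFwdT, ht, h0.2, conjR_apply]
  have hT1 : ‖⟪DVZ - DUZ, DL2 F n K c₀ V CW⟫_ℂ‖ ≤ Real.sqrt 24 * δ * ‖Z‖ * ‖DL2 F n K c₀ V CW‖ := by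
    have e1 : DVZ - DUZ = toL2 F K c₀ ((toL2 F K c₀).symm (DVZ - DUZ)) := ((toL2 F K c₀).apply_symm_apply _).symm
    have e2 : DL2 F n K c₀ V CW = toL2 F K c₀ ((toL2 F K c₀).symm (DL2 F n K c₀ V CW)) := ((toL2 F K c₀).apply_symm_apply _).symm
    rw [e1, e2]
    refine (norm_inner_toL2_le_of_support F _ _ S' hsupp).trans ?_
    rw [← e2]
    refine mul_le_mul_of_nonneg_right ?_ (norm_nonneg _)
    have hsq := normSq_on_DL2_sub_DL2_le F (n := n) (c₀ := c₀) V U z S' (δ := δ) (fun b hb => by rw [norm_sub_rev]; exact hUV b (Finset.mem_filter.mp hb).2)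
    rw [← hZ, ← hDVZ, ← hDUZ] at hsq
    calc Real.sqrt (c₀ * ∑ b ∈ S', ∑ j : Fin 2, ∑ k : Fin 2, ‖((toL2 F K c₀).symm (DVZ - DUZ) b) j k‖ ^ 2)
        ≤ Real.sqrt (24 * δ ^ 2 * ‖Z‖ ^ 2) := Real.sqrt_le_sqrt hsq
      _ = Real.sqrt 24 * δ * ‖Z‖ := by
          rw [Real.sqrt_mul' _ (sq_nonneg _), Real.sqrt_mul' _ (sq_nonneg _), Real.sqrt_sq hδ, Real.sqrt_sq (norm_nonneg _)]
  -- `‖D_V(χw)‖ ≤ ‖D_Vw‖ + √3η⁻¹θ‖w‖`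
  have hDVCW : ‖DL2 F n K c₀ V CW‖ ≤ ‖DVW‖ + Real.sqrt 3 * (eta F n K)⁻¹ * θ * ‖W‖ := by
    have hK := norm_leibnizDefect_le F V χ hθ hχ w (c₀ := c₀) (n := n)
    have hB : ‖toL2 F K c₀ (fun b => χ b.src • (toL2 F K c₀).symm DVW b)‖ ≤ ‖DVW‖ := by
      have h1 := norm_toL2_smul_le F (c₀ := c₀) (fun b : PBond (F.P K) 0 => χ b.src) zero_le_one (fun b => hχ1 b.src) ((toL2 F K c₀).symm DVW)
      rw [one_mul, LinearEquiv.apply_symm_apply] at h1; exact h1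
    calc ‖DL2 F n K c₀ V CW‖ = ‖(DL2 F n K c₀ V CW - toL2 F K c₀ (fun b => χ b.src • (toL2 F K c₀).symm DVW b)) + toL2 F K c₀ (fun b => χ b.src • (toL2 F K c₀).symm DVW b)‖ := by
          rw [sub_add_cancel]
      _ ≤ ‖DL2 F n K c₀ V CW - toL2 F K c₀ (fun b => χ b.src • (toL2 F K c₀).symm DVW b)‖ + ‖toL2 F K c₀ (fun b => χ b.src • (toL2 F K c₀).symm DVW b)‖ := norm_add_le _ _
      _ ≤ Real.sqrt 3 * (eta F n K)⁻¹ * θ * ‖W‖ + ‖DVW‖ := add_le_add hK hB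
      _ = _ := by ring
  -- assemble
  rw [hmain, map_add]
  have hA : |RCLike.re ⟪DVZ - DUZ, DL2 F n K c₀ V CW⟫_ℂ| ≤ Real.sqrt 24 * δ * ‖Z‖ * ‖DL2 F n K c₀ V CW‖ := (RCLike.abs_re_le_norm _).trans hT1
  have hB : |RCLike.re ⟪DUZ, DL2 F n K c₀ V CW - DL2 F n K c₀ U CW⟫_ℂ| ≤ ‖DUZ‖ * (Real.sqrt 24 * δ * ‖W‖) :=
    (RCLike.abs_re_le_norm _).trans ((norm_inner_le_norm _ _).trans (mul_le_mul_of_nonneg_left hT2 (norm_nonneg _)))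
  have h24 : 0 ≤ Real.sqrt 24 * δ * ‖Z‖ := by positivity
  calc |RCLike.re ⟪DVZ - DUZ, DL2 F n K c₀ V CW⟫_ℂ + RCLike.re ⟪DUZ, DL2 F n K c₀ V CW - DL2 F n K c₀ U CW⟫_ℂ|
      ≤ Real.sqrt 24 * δ * ‖Z‖ * ‖DL2 F n K c₀ V CW‖ + ‖DUZ‖ * (Real.sqrt 24 * δ * ‖W‖) := (abs_add_le _ _).trans (add_le_add hA hB)
    _ ≤ Real.sqrt 24 * δ * ‖Z‖ * (‖DVW‖ + Real.sqrt 3 * (eta F n K)⁻¹ * θ * ‖W‖) + ‖DUZ‖ * (Real.sqrt 24 * δ * ‖W‖) :=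
        add_le_add (mul_le_mul_of_nonneg_left hDVCW h24) le_rfl
    _ = _ := by ring

/-! ## §3 The massless twisted difference in the `hform` shape of ✓`norm_inv_cutoff_comm_le_of_form` -/

/-- ★★★ **THE MEMBER `hform` ROW, MASSLESS PART**: under the hypotheses of §1–§2 (block-Lipschitz `χ` with steps `≤ θ`, `|χ| ≤ 1`, `‖U_b − V_b‖ ≤ δη` on every bond meeting
`supp χ`), with `c := √3η⁻¹θ + √24δ + 2·(√3η⁻¹θ)(√24δ)`:
`|re⟪toL2S z, X(Δ_V(toL2S w)) − Δ_U(X(toL2S w))⟫| ≤ (c·‖D_V(toL2S w)‖ + c·‖toL2S w‖)·(‖D_U(toL2S z)‖ + ‖toL2S z‖)` — the `hform` binder of ✓p750050 for `A_U := Δ_U`, `A_V := Δ_V`,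
`D̃_U := D_U`, `D̃_V := D_V`, `X := χ·`, K-free at `θ ≤ η∕(R″−R′)`, `δ = 6R″ε₀`. [cite: Balaban1985BackgroundPropagators, Thm 3.3 p.399, (3.100)–(3.105) pp.413–414] -/
theorem abs_re_inner_twisted_laplacian_le (χ : Site (F.P K) 0 → ℝ) {θ δ : ℝ} (hθ : 0 ≤ θ) (hδ : 0 ≤ δ) (hχ1 : ∀ x, |χ x| ≤ 1)
    (hχ : ∀ (x : Site (F.P K) 0) (μ : Fin 3), |χ (x.shift μ) - χ x| ≤ θ)
    (hUV : ∀ b : PBond (F.P K) 0, (χ b.tgt ≠ 0 ∨ χ b.src ≠ 0) →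
      ‖((bgUnits F K U b : (Matrix (Fin 2) (Fin 2) ℂ)ˣ) : Matrix (Fin 2) (Fin 2) ℂ) - ((bgUnits F K V b : (Matrix (Fin 2) (Fin 2) ℂ)ˣ) : Matrix (Fin 2) (Fin 2) ℂ)‖ ≤ δ * eta F n K)
    (X : SiteL2K ℂ 3 (periodsT3 F K) c₀ W₂ →ₗ[ℂ] SiteL2K ℂ 3 (periodsT3 F K) c₀ W₂)
    (hX : ∀ l : Site (F.P K) 0 → Matrix (Fin 2) (Fin 2) ℂ, X (toL2S F K c₀ l) = toL2S F K c₀ (fun x => χ x • l x))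
    (z w : Site (F.P K) 0 → Matrix (Fin 2) (Fin 2) ℂ) :
    |RCLike.re ⟪toL2S F K c₀ z, X (covLapSite F n K c₀ V (toL2S F K c₀ w)) - covLapSite F n K c₀ U (X (toL2S F K c₀ w))⟫_ℂ|
      ≤ ((Real.sqrt 3 * (eta F n K)⁻¹ * θ + Real.sqrt 24 * δ + 2 * (Real.sqrt 3 * (eta F n K)⁻¹ * θ) * (Real.sqrt 24 * δ)) * ‖DL2 F n K c₀ V (toL2S F K c₀ w)‖
          + (Real.sqrt 3 * (eta F n K)⁻¹ * θ + Real.sqrt 24 * δ + 2 * (Real.sqrt 3 * (eta F n K)⁻¹ * θ) * (Real.sqrt 24 * δ)) * ‖toL2S F K c₀ w‖)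
        * (‖DL2 F n K c₀ U (toL2S F K c₀ z)‖ + ‖toL2S F K c₀ z‖) := by
  have hη : 0 < eta F n K := eta_pos F n K
  have hUV' : ∀ b : PBond (F.P K) 0, χ b.tgt ≠ χ b.src →
      ‖((bgUnits F K U b : (Matrix (Fin 2) (Fin 2) ℂ)ˣ) : Matrix (Fin 2) (Fin 2) ℂ) - ((bgUnits F K V b : (Matrix (Fin 2) (Fin 2) ℂ)ˣ) : Matrix (Fin 2) (Fin 2) ℂ)‖ ≤ δ * eta F n K := by
    intro b hb
    refine hUV b ?_
    by_contra h0
    have h1 : χ b.tgt = 0 := by_contra fun h => h0 (Or.inl h)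
    have h2 : χ b.src = 0 := by_contra fun h => h0 (Or.inr h)
    exact hb (by rw [h1, h2])
  have h1 := abs_re_inner_comm_covLapSite_le F U V χ hθ hδ hχ hUV' X hX z w
  have h2 := abs_re_inner_covLapSite_sub_smul_le F (n := n) (c₀ := c₀) U V χ hθ hδ hχ1 hχ hUV z w
  -- split `X Δ_V W − Δ_U X W = (X Δ_V W − Δ_V X W) + (Δ_V X W − Δ_U X W)`
  have hsplit : X (covLapSite F n K c₀ V (toL2S F K c₀ w)) - covLapSite F n K c₀ U (X (toL2S F K c₀ w))
      = (X (covLapSite F n K c₀ V (toL2S F K c₀ w)) - covLapSite F n K c₀ V (X (toL2S F K c₀ w)))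
        + (covLapSite F n K c₀ V (toL2S F K c₀ (fun x => χ x • w x)) - covLapSite F n K c₀ U (toL2S F K c₀ (fun x => χ x • w x))) := by
    rw [hX]; abel
  rw [hsplit, inner_add_right, map_add]
  refine (abs_add_le _ _).trans ((add_le_add h1 h2).trans ?_)
  set A : ℝ := Real.sqrt 3 * (eta F n K)⁻¹ * θ with hA
  set B : ℝ := Real.sqrt 24 * δ with hB
  set nZ := ‖toL2S F K c₀ z‖
  set nW := ‖toL2S F K c₀ w‖
  set dVW := ‖DL2 F n K c₀ V (toL2S F K c₀ w)‖
  set dUZ := ‖DL2 F n K c₀ U (toL2S F K c₀ z)‖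
  have hA0 : 0 ≤ A := by positivity
  have hB0 : 0 ≤ B := by positivity
  have hZ0 : 0 ≤ nZ := norm_nonneg _
  have hW0 : 0 ≤ nW := norm_nonneg _
  have hdVW : 0 ≤ dVW := norm_nonneg _
  have hdUZ : 0 ≤ dUZ := norm_nonneg _
  have hB' : Real.sqrt 24 * δ * nZ = B * nZ := by rw [hB]
  nlinarith [mul_nonneg hA0 hB0, mul_nonneg (mul_nonneg hA0 hB0) (mul_nonneg hZ0 hW0), mul_nonneg hA0 (mul_nonneg hdVW hdUZ), mul_nonneg hB0 (mul_nonneg hdVW hdUZ),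
    mul_nonneg (mul_nonneg hA0 hB0) (mul_nonneg hdVW hdUZ), mul_nonneg (mul_nonneg hA0 hB0) (mul_nonneg hdVW hZ0), mul_nonneg (mul_nonneg hA0 hB0) (mul_nonneg hW0 hdUZ),
    mul_nonneg hA0 (mul_nonneg hW0 hZ0), mul_nonneg hB0 (mul_nonneg hW0 hZ0)]

end Summit.QuantumFields.YangMills.Theorems.Prop7CutoffLaplacianFormRows

end
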